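import Summits.AtomisticToContinuum.FouriersLaw.Theorems.BondHeatUncertaintyBoundedResponseBathHeatDCBandA
import HarnessLib

/-!
# BondHeatUncertainty / BoundedResponse — «DCBand» §4–§5: THE DOOR `(FC) ∧ (BDF_θ) ∧ (D) ⟹ OhmicFloor ⟺ 11071` (`θ > 0`;
`ohmicFloor_of_deficitCesaroPoint_bandDeficitFloor`, beneath (S) `boundedResponse_of_subdiffusiveBondHeat_bandDeficitFloor`), its NECESSITY
(`bandDeficitFloor_of_ohmicFloor`, every `θ ≥ 0`) and EXACTNESS beneath (FC) ∧ (D) (`boundedResponse_iff_bandDeficitFloor`), the LADDER IN `θ`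
(antitone; `θ ≤ 0` free beneath (FC); suppliers `WarburgDipFloor` / `WarburgDipNonneg` / `BoundaryDEP` / `BathKernelFloor 0 (3/2)` for `θ ≤ 1`) and
★ its SATURATION (`θ > 1` ⟹ the blocker outright, `ohmicFloor_of_bandDeficitFloor_of_one_lt`; `bandDeficitFloor_iff_ohmicFloor_of_one_lt`)
(decomp-a2c lens-1 g117, NODE 117 «DCBand»; part 2 of 3; imports part A `…BathHeatDCBandA` (object, identity, pieces, engine); the main file
`…BathHeatDCBand` carries (TV) ⟹ (FC), the weakest time-side supplier (BNM) and the OVERVIEW docstring)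

No `sorry`, no new axioms; every hypothesis of a door is one of the cell's docstring-tagged route statements or a tree statement.
-/

noncomputable section

open MeasureTheory ProbabilityTheory Filter Topology Set Function
open scoped NNReal ENNReal
open Literature.MathematicalPhysics.KineticTheory.HeatConduction
open Literature.MathematicalPhysics.KineticTheory OscillatorChain
open Literature.Probability.Process
open Summit.AtomisticToContinuum.FouriersLaw.Theorems.SubdiffusiveBondHeat
open Summit.AtomisticToContinuum.FouriersLaw.Theorems.SubdiffusiveBondHeat.EscapeGrading
open Summit.AtomisticToContinuum.FouriersLaw.Theorems.OddSectorIrreversibility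

namespace Summit.AtomisticToContinuum.FouriersLaw.Theorems.BoundedResponse.HeatSpreading

open Summit.AtomisticToContinuum.FouriersLaw.Theorems.BoundedResponse.TransientContact
open Summit.AtomisticToContinuum.FouriersLaw.Theorems.BoundedResponse.TransientBand
open Summit.AtomisticToContinuum.FouriersLaw.Theses.BondHeatUncertainty (BoundedResponse SubdiffusiveBondHeat)
open Summit.AtomisticToContinuum.FouriersLaw.Theses.GriffithsLimitExchange (BoundaryDEP)

/-! ## §4 The door and the ladder -/

/-- (FC) in dip form: `M_N(ω) ≥ −E_N` for every `ω` — the mirror image of the tree's `warburgDip_le_oneSubEscapeDeficit` (`M_N ≤ 1 − E_N`). [this cell] -/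
theorem neg_escapeDeficit_le_warburgDip_of_spectralDeficitNonneg (hFC : SpectralDeficitNonneg) :
    ∀ ω₂ lam β γ : ℝ, 0 < ω₂ → 0 < lam → 0 < β → 0 < γ → ∀ T : ℝ, 0 < T → ∀ N : ℕ, 2 ≤ N → ∀ ω : ℝ,
      -escapeDeficit ω₂ lam β γ T N ≤ warburgDip ω₂ lam β γ T N ω := by
  intro ω₂ lam β γ hω hl hβ hγ T hT N hN ω
  have h := hFC ω₂ lam β γ hω hl hβ hγ T hT N hN ω
  rw [spectralDeficit_eq_escapeDeficit_add_warburgDip hω hl hβ hγ hT N ω] at h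
  linarith

/-- ★ **THE FRACTIONAL CESÀRO FLOOR — (FC) ∧ (BDF_θ) ⟹ `c₁·W_N(cN²) ≥ (43/96)·cN²·(θE_N − η/N)`** eventually in `N`, for every `c > 0`
(what the band floor buys WITHOUT (D); at `θ = 1` a floor `W_N(t) ≳ 0.28·tE_N − O(N)`, versus `W_N(t) ≥ tE_N − O(N)` from `TransientFloor 1`). [this cell] -/
theorem deficitCesaro_ge_of_bandDeficitFloor {θ : ℝ} (hFC : SpectralDeficitNonneg) (hB : BandDeficitFloor θ) :
    ∀ ω₂ lam β γ : ℝ, 0 < ω₂ → 0 < lam → 0 < β → 0 < γ → ∀ T : ℝ, 0 < T → ∀ c : ℝ, 0 < c →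
      ∃ η : ℝ, ∃ N₀ : ℕ, ∀ N : ℕ, N₀ ≤ N →
        43 / 96 * (c * (N : ℝ) ^ 2) * (θ * escapeDeficit ω₂ lam β γ T N - η / (N : ℝ)) ≤
          (∫ ω in Ioi (0 : ℝ), (1 - Real.cos ω) / ω ^ 2) * deficitCesaro ω₂ lam β γ T N (c * (N : ℝ) ^ 2) := by
  intro ω₂ lam β γ hω hl hβ hγ T hT c hc
  obtain ⟨η, N₀, hη⟩ := hB ω₂ lam β γ hω hl hβ hγ T hT c hc
  refine ⟨η, max N₀ 2, fun N hN => ?_⟩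
  have hNN₀ : N₀ ≤ N := le_trans (le_max_left _ _) hN
  have hN2 : 2 ≤ N := le_trans (le_max_right _ _) hN
  have hNpos : (0 : ℝ) < N := by exact_mod_cast lt_of_lt_of_le (Nat.succ_pos 1) hN2
  have ht : 0 < c * (N : ℝ) ^ 2 := by positivity
  set m : ℝ := θ * escapeDeficit ω₂ lam β γ T N - η / (N : ℝ) with hm
  rw [deficitCesaro_eq_spectral hω hl hβ hγ hT N ht.le]
  rcases le_or_gt m 0 with hm0 | hm0
  · -- nothing to prove beyond the free sign
    have h0 : 0 ≤ ∫ ω in Ioi (0 : ℝ), (1 - Real.cos (ω * (c * (N : ℝ) ^ 2))) / ω ^ 2 * spectralDeficit ω₂ lam β γ T N ω :=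
      setIntegral_nonneg measurableSet_Ioi fun ω' _ =>
        mul_nonneg (div_nonneg (one_sub_cos_mem_Icc _).1 (sq_nonneg _)) (hFC ω₂ lam β γ hω hl hβ hγ T hT N hN2 ω')
    have : 43 / 96 * (c * (N : ℝ) ^ 2) * m ≤ 0 := mul_nonpos_of_nonneg_of_nonpos (by positivity) hm0
    linarith
  · have h := integral_fejer_mul_ge_of_bandFloor ht hm0.le
      (integrableOn_fejer_mul_spectralDeficit hω hl hβ hγ hT N ht.le)
      (fun ω hω0 => hFC ω₂ lam β γ hω hl hβ hγ T hT N hN2 ω) (fun ω hω0 hωt => hη N hNN₀ ω hω0 hωt)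
    linarith

/-- ★★ **THE DOOR — (FC) ∧ (BDF_θ) ∧ (D) ⟹ OhmicFloor** for every `θ > 0`: `(43/96)cN²(θE_N − η/N) ≤ c₁W_N(cN²) ≤ c₁C·N`. [this cell] -/
theorem ohmicFloor_of_deficitCesaroPoint_bandDeficitFloor {θ : ℝ} (hθ : 0 < θ) (hFC : SpectralDeficitNonneg)
    (hB : BandDeficitFloor θ) (hD : DeficitCesaroPoint) : OhmicFloor := by
  intro ω₂ lam β γ hω hl hβ hγ T hT
  obtain ⟨C, c, hc, N₀, hW⟩ := hD ω₂ lam β γ hω hl hβ hγ T hT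
  obtain ⟨η, N₁, hη⟩ := deficitCesaro_ge_of_bandDeficitFloor hFC hB ω₂ lam β γ hω hl hβ hγ T hT c hc
  set c₁ : ℝ := ∫ ω in Ioi (0 : ℝ), (1 - Real.cos ω) / ω ^ 2 with hc₁
  have hc₁pos : 0 < c₁ := integral_one_sub_cos_div_sq_pos
  refine ⟨(max η 0 + 96 / 43 * c₁ * max C 0 / c) / θ, max (max N₀ N₁) 1, fun N hN => ?_⟩
  have hNN₀ : N₀ ≤ N := le_trans (le_trans (le_max_left _ _) (le_max_left _ _)) hN
  have hNN₁ : N₁ ≤ N := le_trans (le_trans (le_max_right _ _) (le_max_left _ _)) hN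
  have hNpos : (0 : ℝ) < N := by exact_mod_cast lt_of_lt_of_le Nat.one_pos (le_trans (le_max_right _ _) hN)
  have h1 := hW N hNN₀
  have h2 := hη N hNN₁
  set E := escapeDeficit ω₂ lam β γ T N with hE
  have hCN : c₁ * deficitCesaro ω₂ lam β γ T N (c * (N : ℝ) ^ 2) ≤ c₁ * (max C 0 * N) :=
    mul_le_mul_of_nonneg_left (h1.trans (mul_le_mul_of_nonneg_right (le_max_left _ _) hNpos.le)) hc₁pos.le
  -- `(43/96) c N² (θE − η/N) ≤ c₁ C⁺ N`; cancel the positive factor `(43/96)·c·N`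
  have key : 43 / 96 * (c * (N : ℝ) ^ 2) * (θ * E - η / N) ≤ c₁ * (max C 0 * N) := h2.trans hCN
  have hfac : 0 < 43 / 96 * c * (N : ℝ) := by positivity
  have eL : 43 / 96 * (c * (N : ℝ) ^ 2) * (θ * E - η / N) = 43 / 96 * c * (N : ℝ) * (θ * E * N - η) := by
    field_simp
  have eR : c₁ * (max C 0 * (N : ℝ)) = 43 / 96 * c * (N : ℝ) * (96 / 43 * c₁ * max C 0 / c) := by
    field_simp
  rw [eL, eR] at key
  have key' : θ * E * N - η ≤ 96 / 43 * c₁ * max C 0 / c := le_of_mul_le_mul_left key hfac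
  rw [div_div, le_div_iff₀ (mul_pos hθ hNpos)]
  calc E * (θ * N) = θ * E * N := by ring
    _ ≤ η + 96 / 43 * c₁ * max C 0 / c := by linarith
    _ ≤ max η 0 + 96 / 43 * c₁ * max C 0 / c := by linarith [le_max_left η 0]

/-- **(FC) ∧ (BDF_θ) ∧ (D) ⟹ BoundedResponse (stmt-AtomisticToContinuum-11071)**, `θ > 0`. [this cell] -/
theorem boundedResponse_of_deficitCesaroPoint_bandDeficitFloor {θ : ℝ} (hθ : 0 < θ) (hFC : SpectralDeficitNonneg)
    (hB : BandDeficitFloor θ) (hD : DeficitCesaroPoint) : BoundedResponse :=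
  ohmicFloor_iff_boundedResponse.1 (ohmicFloor_of_deficitCesaroPoint_bandDeficitFloor hθ hFC hB hD)

/-- **(BHᴾ_1) ⟹ (D)**: `W_N^{bath} = 2γT²·W_N` (`deficitCesaroPoint_of_bathHeatPoint_one`). [this cell] -/
theorem deficitCesaroPoint_of_bathHeatPoint_one (hP : BathHeatPoint 1) : DeficitCesaroPoint := by
  intro ω₂ lam β γ hω hl hβ hγ T hT
  obtain ⟨C, c, hc, N₀, hCN⟩ := hP ω₂ lam β γ hω hl hβ hγ T hT
  refine ⟨C / (2 * γ * T ^ 2), c, hc, max N₀ 1, fun N hN => ?_⟩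
  have hNN₀ : N₀ ≤ N := le_trans (le_max_left _ _) hN
  have hN1 : 0 < N := lt_of_lt_of_le Nat.one_pos (le_trans (le_max_right _ _) hN)
  have h := hCN N hNN₀
  rw [Real.rpow_one, bathHeatVar_eq_deficitCesaro hω hl hβ hγ hT hN1 (by positivity)] at h
  have hγT : 0 < 2 * γ * T ^ 2 := by positivity
  rw [div_mul_eq_mul_div, le_div_iff₀ hγT]
  linarith

/-- **(D) ⟹ (BHᴾ_1)** (converse bookkeeping: the two Thouless-point ceilings are one statement). [this cell] -/
theorem bathHeatPoint_one_of_deficitCesaroPoint (hD : DeficitCesaroPoint) : BathHeatPoint 1 := by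
  intro ω₂ lam β γ hω hl hβ hγ T hT
  obtain ⟨C, c, hc, N₀, hCN⟩ := hD ω₂ lam β γ hω hl hβ hγ T hT
  refine ⟨2 * γ * T ^ 2 * C, c, hc, max N₀ 1, fun N hN => ?_⟩
  have hNN₀ : N₀ ≤ N := le_trans (le_max_left _ _) hN
  have hN1 : 0 < N := lt_of_lt_of_le Nat.one_pos (le_trans (le_max_right _ _) hN)
  have h := hCN N hNN₀
  rw [Real.rpow_one, bathHeatVar_eq_deficitCesaro hω hl hβ hγ hT hN1 (by positivity)]
  have hγT : 0 < 2 * γ * T ^ 2 := by positivity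
  nlinarith [mul_le_mul_of_nonneg_left h hγT.le]

/-- **(BHᴾ_1) ⟺ (D)**: NODE 107's bath-heat Thouless point and NODE 92's Cesàro-deficit Thouless point are one statement. [this cell] -/
theorem bathHeatPoint_one_iff_deficitCesaroPoint : BathHeatPoint 1 ↔ DeficitCesaroPoint :=
  ⟨deficitCesaroPoint_of_bathHeatPoint_one, bathHeatPoint_one_of_deficitCesaroPoint⟩

/-- ★★ **THE DOOR IN BATH CURRENCY — (FC) ∧ (BDF_θ) ∧ (BHᴾ_1) ⟹ 11071**, `θ > 0`. [this cell] -/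
theorem boundedResponse_of_bathHeatPoint_bandDeficitFloor {θ : ℝ} (hθ : 0 < θ) (hFC : SpectralDeficitNonneg)
    (hB : BandDeficitFloor θ) (hP : BathHeatPoint 1) : BoundedResponse :=
  boundedResponse_of_deficitCesaroPoint_bandDeficitFloor hθ hFC hB (deficitCesaroPoint_of_bathHeatPoint_one hP)

/-- ★★ **BENEATH (S) — (S) ∧ (FC) ∧ (BDF_θ) ⟹ 11071**, `θ > 0` (`(S) ⟹ (BHᴾ_1)`, tree). [this cell] -/
theorem boundedResponse_of_subdiffusiveBondHeat_bandDeficitFloor {θ : ℝ} (hθ : 0 < θ) (hS : SubdiffusiveBondHeat)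
    (hFC : SpectralDeficitNonneg) (hB : BandDeficitFloor θ) : BoundedResponse :=
  boundedResponse_of_bathHeatPoint_bandDeficitFloor hθ hFC hB (bathHeatPoint_one_of_subdiffusiveBondHeat hS)

/-- ★ **NECESSITY — OhmicFloor ∧ (FC) ⟹ (BDF_θ)** for every `θ ≥ 0`: `h_N(ω) ≥ 0 ≥ θE_N − θC₁⁺/N`. [this cell] -/
theorem bandDeficitFloor_of_ohmicFloor {θ : ℝ} (hθ : 0 ≤ θ) (hFC : SpectralDeficitNonneg) (hO : OhmicFloor) :
    BandDeficitFloor θ := by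
  intro ω₂ lam β γ hω hl hβ hγ T hT c hc
  obtain ⟨C₁, N₀, hC₁⟩ := hO ω₂ lam β γ hω hl hβ hγ T hT
  refine ⟨θ * max C₁ 0, max N₀ 2, fun N hN ω hω0 hωt => ?_⟩
  have hNN₀ : N₀ ≤ N := le_trans (le_max_left _ _) hN
  have hN2 : 2 ≤ N := le_trans (le_max_right _ _) hN
  have hNpos : (0 : ℝ) < N := by exact_mod_cast lt_of_lt_of_le (Nat.succ_pos 1) hN2
  have hE : escapeDeficit ω₂ lam β γ T N ≤ max C₁ 0 / N :=
    (hC₁ N hNN₀).trans (div_le_div_of_nonneg_right (le_max_left _ _) hNpos.le)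
  have h0 := hFC ω₂ lam β γ hω hl hβ hγ T hT N hN2 ω
  have : θ * escapeDeficit ω₂ lam β γ T N ≤ θ * max C₁ 0 / N := by
    rw [mul_div_assoc]; exact mul_le_mul_of_nonneg_left hE hθ
  linarith

/-- **BoundedResponse ∧ (FC) ⟹ (BDF_θ)**, `θ ≥ 0`. [this cell] -/
theorem bandDeficitFloor_of_boundedResponse {θ : ℝ} (hθ : 0 ≤ θ) (hFC : SpectralDeficitNonneg) (hBR : BoundedResponse) :
    BandDeficitFloor θ :=
  bandDeficitFloor_of_ohmicFloor hθ hFC (ohmicFloor_iff_boundedResponse.2 hBR)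

/-- ★ **EXACTNESS — beneath (FC) ∧ (D), `BoundedResponse ⟺ BandDeficitFloor θ` for every `θ > 0`.** [this cell] -/
theorem boundedResponse_iff_bandDeficitFloor {θ : ℝ} (hθ : 0 < θ) (hFC : SpectralDeficitNonneg) (hD : DeficitCesaroPoint) :
    BoundedResponse ↔ BandDeficitFloor θ :=
  ⟨bandDeficitFloor_of_boundedResponse hθ.le hFC, fun hB => boundedResponse_of_deficitCesaroPoint_bandDeficitFloor hθ hFC hB hD⟩

/-- **Beneath (S) ∧ (FC): `BoundedResponse ⟺ BandDeficitFloor θ`** (`θ > 0`). [this cell] -/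
theorem boundedResponse_iff_bandDeficitFloor_of_subdiffusiveBondHeat {θ : ℝ} (hθ : 0 < θ) (hS : SubdiffusiveBondHeat)
    (hFC : SpectralDeficitNonneg) : BoundedResponse ↔ BandDeficitFloor θ :=
  boundedResponse_iff_bandDeficitFloor hθ hFC (deficitCesaroPoint_of_bathHeatPoint_one (bathHeatPoint_one_of_subdiffusiveBondHeat hS))

/-- **The grade is antitone**: `θ ≤ θ' ⟹ (BDF_θ') ⟹ (BDF_θ)` (`E_N ≥ 0` for `N ≥ 2`). [this cell] -/
theorem bandDeficitFloor_anti {θ θ' : ℝ} (hθθ' : θ ≤ θ') : BandDeficitFloor θ' → BandDeficitFloor θ := by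
  intro h ω₂ lam β γ hω hl hβ hγ T hT c hc
  obtain ⟨η, N₀, hη⟩ := h ω₂ lam β γ hω hl hβ hγ T hT c hc
  refine ⟨η, max N₀ 2, fun N hN ω hω0 hωt => ?_⟩
  have h1 := hη N (le_trans (le_max_left _ _) hN) ω hω0 hωt
  have hE := escapeDeficit_nonneg' hω hl hβ hγ hT (show 2 ≤ N from le_trans (le_max_right _ _) hN)
  nlinarith

/-- **Free rungs `θ ≤ 0` given (FC)**: `h_N ≥ 0 ≥ θE_N`. [this cell] -/
theorem bandDeficitFloor_of_nonpos {θ : ℝ} (hθ : θ ≤ 0) (hFC : SpectralDeficitNonneg) : BandDeficitFloor θ := by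
  intro ω₂ lam β γ hω hl hβ hγ T hT c hc
  refine ⟨0, 2, fun N hN ω hω0 hωt => ?_⟩
  have h0 := hFC ω₂ lam β γ hω hl hβ hγ T hT N hN ω
  have hE := escapeDeficit_nonneg' hω hl hβ hγ hT (show 2 ≤ N from hN)
  have : θ * escapeDeficit ω₂ lam β γ T N ≤ 0 := mul_nonpos_of_nonpos_of_nonneg hθ hE
  rw [zero_div, sub_zero]
  linarith

/-- ★ **`WarburgDipFloor ⟹ (BDF_θ)` for `θ ≤ 1`**: on the band `√ω ≤ 1/(√c·N)`, so `h_N = E_N + M_N ≥ E_N − A√ω ≥ θE_N − (A⁺/√c)/N`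
(`N` large: `1/(cN²) ≤ 1`, `E_N ≥ 0`).  The 92T floor hypothesis restricted to the band; the converse is not claimed. [this cell] -/
theorem bandDeficitFloor_of_warburgDipFloor {θ : ℝ} (hθ : θ ≤ 1) (hF : WarburgDipFloor) : BandDeficitFloor θ := by
  intro ω₂ lam β γ hω hl hβ hγ T hT c hc
  obtain ⟨A, N₀, hA⟩ := hF ω₂ lam β γ hω hl hβ hγ T hT
  have hsc : 0 < Real.sqrt c := Real.sqrt_pos.2 hc
  refine ⟨max A 0 / Real.sqrt c, max (max N₀ 2) (⌈1 / Real.sqrt c⌉₊ + 1), fun N hN ω hω0 hωt => ?_⟩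
  have hNN₀ : N₀ ≤ N := le_trans (le_trans (le_max_left _ _) (le_max_left _ _)) hN
  have hN2 : 2 ≤ N := le_trans (le_trans (le_max_right _ _) (le_max_left _ _)) hN
  have hN1 : ⌈1 / Real.sqrt c⌉₊ + 1 ≤ N := le_trans (le_max_right _ _) hN
  have hNr : 1 / Real.sqrt c < (N : ℝ) := by
    have h' : (⌈1 / Real.sqrt c⌉₊ : ℝ) + 1 ≤ N := by exact_mod_cast hN1
    linarith [Nat.le_ceil (1 / Real.sqrt c)]
  have hNpos : (0 : ℝ) < N := lt_trans (by positivity) hNr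
  have ht1 : (1 : ℝ) ≤ c * (N : ℝ) ^ 2 := by
    have h1 : 1 < Real.sqrt c * N := by rwa [div_lt_iff₀ hsc, mul_comm] at hNr
    have h2 : (Real.sqrt c * N) ^ 2 = c * (N : ℝ) ^ 2 := by rw [mul_pow, Real.sq_sqrt hc.le]
    nlinarith
  -- `ω ≤ 1` and `√ω ≤ 1/(√c N)`
  have hω1 : ω ≤ 1 := by nlinarith
  have hωabs : |ω| ≤ 1 := by rw [abs_of_pos hω0]; exact hω1
  have hsω : Real.sqrt ω * (Real.sqrt c * N) ≤ 1 := by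
    have h1 : Real.sqrt ω * (Real.sqrt c * N) = Real.sqrt (ω * (c * (N : ℝ) ^ 2)) := by
      rw [Real.sqrt_mul hω0.le, Real.sqrt_mul hc.le, Real.sqrt_sq hNpos.le]
    rw [h1, ← Real.sqrt_one]
    exact Real.sqrt_le_sqrt hωt
  have hM := hA N hNN₀ ω hωabs
  rw [abs_of_pos hω0] at hM
  have hE := escapeDeficit_nonneg' hω hl hβ hγ hT hN2
  rw [spectralDeficit_eq_escapeDeficit_add_warburgDip hω hl hβ hγ hT N ω]
  -- `A√ω ≤ (A⁺/√c)/N`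
  have hAω : A * Real.sqrt ω ≤ max A 0 / Real.sqrt c / N := by
    have h1 : A * Real.sqrt ω ≤ max A 0 * Real.sqrt ω := mul_le_mul_of_nonneg_right (le_max_left _ _) (Real.sqrt_nonneg _)
    have h2 : max A 0 * Real.sqrt ω ≤ max A 0 / Real.sqrt c / N := by
      rw [div_div, le_div_iff₀ (mul_pos hsc hNpos)]
      calc max A 0 * Real.sqrt ω * (Real.sqrt c * N) = max A 0 * (Real.sqrt ω * (Real.sqrt c * N)) := by ring
        _ ≤ max A 0 * 1 := mul_le_mul_of_nonneg_left hsω (le_max_right _ _)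
        _ = max A 0 := mul_one _
    exact h1.trans h2
  have hθE : θ * escapeDeficit ω₂ lam β γ T N ≤ escapeDeficit ω₂ lam β γ T N := by nlinarith
  linarith

/-- `WarburgDipNonneg ⟹ (BDF_θ)` (`θ ≤ 1`), hence `BoundaryDEP ⟹ (BDF_θ)`. [this cell] -/
theorem bandDeficitFloor_of_warburgDipNonneg {θ : ℝ} (hθ : θ ≤ 1) (h : WarburgDipNonneg) : BandDeficitFloor θ :=
  bandDeficitFloor_of_warburgDipFloor hθ (warburgDipFloor_of_warburgDipNonneg h)

/-- `BoundaryDEP ⟹ (BDF_θ)` (`θ ≤ 1`). [this cell] -/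
theorem bandDeficitFloor_of_boundaryDEP {θ : ℝ} (hθ : θ ≤ 1) (h : BoundaryDEP) : BandDeficitFloor θ :=
  bandDeficitFloor_of_warburgDipNonneg hθ (warburgDipNonneg_of_boundaryDEP h)

/-- **`BathKernelFloor 0 (3/2) ⟹ (BDF_θ)`** (`θ ≤ 1`): the amplitude-free pointwise kernel floor `K_N(r) ≥ −A r^{−3/2}` — the typed (S)-side supplier of
the residual of record (`bathTailFloor_one_of_bathKernelFloor`, NODE 107; fed by NODE 108's cumulant floors) — supplies the band floor as well, through
NODE 108's `warburgDipFloor_of_bathKernelFloor`.  So every typed sufficient piece of the lineage beneath (S) enters BOTH residual doors. [this cell] -/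
theorem bandDeficitFloor_of_bathKernelFloor {θ : ℝ} (hθ : θ ≤ 1) (hK : BathKernelFloor 0 (3 / 2)) : BandDeficitFloor θ :=
  bandDeficitFloor_of_warburgDipFloor hθ (warburgDipFloor_of_bathKernelFloor hK)

/-- **Beneath (S), the kernel floor closes the blocker through the band door too** (consistency with NODE 107/108's door; needs (FC)). [this cell] -/
theorem boundedResponse_of_subdiffusiveBondHeat_bathKernelFloor_viaBand (hS : SubdiffusiveBondHeat) (hFC : SpectralDeficitNonneg)
    (hK : BathKernelFloor 0 (3 / 2)) : BoundedResponse :=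
  boundedResponse_of_subdiffusiveBondHeat_bandDeficitFloor one_pos hS hFC (bandDeficitFloor_of_bathKernelFloor le_rfl hK)

/-! ## §5 Saturation of the grade: above `θ = 1` the band floor is the blocker itself -/

/-- ★ **SATURATION — `(BDF_θ) ⟹ OhmicFloor` for every `θ > 1`, with NO ceiling (D) and NO (FC)**: letting `ω → 0⁺` in the band inequality
(`h_N` is continuous at fixed `N`, `h_N(0) = E_N`) gives `θE_N − η/N ≤ E_N`, i.e. `E_N ≤ η/((θ − 1)N)`.  So the ladder reads: `θ ≤ 0` FREE beneath (FC) ·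
`0 < θ ≤ 1` THE RESIDUAL (blocker beneath (FC) ∧ (D), implied by `WarburgDipFloor`) · `θ > 1` COSTUME (the blocker itself, up to (FC)).  Honest tag for the
super-critical grades; the informative rungs are `θ ∈ (0, 1]`. [this cell] -/
theorem ohmicFloor_of_bandDeficitFloor_of_one_lt {θ : ℝ} (hθ : 1 < θ) (hB : BandDeficitFloor θ) : OhmicFloor := by
  intro ω₂ lam β γ hω hl hβ hγ T hT
  obtain ⟨η, N₀, hη⟩ := hB ω₂ lam β γ hω hl hβ hγ T hT 1 one_pos
  refine ⟨η / (θ - 1), max N₀ 1, fun N hN => ?_⟩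
  have hNN₀ : N₀ ≤ N := le_trans (le_max_left _ _) hN
  have hNpos : (0 : ℝ) < N := by exact_mod_cast lt_of_lt_of_le Nat.one_pos (le_trans (le_max_right _ _) hN)
  have hθ1 : 0 < θ - 1 := by linarith
  have ht : 0 < 1 * (N : ℝ) ^ 2 := by positivity
  -- the band inequality survives the limit `ω → 0⁺`
  have hlim : θ * escapeDeficit ω₂ lam β γ T N - η / N ≤ spectralDeficit ω₂ lam β γ T N 0 := by
    have hcont : Tendsto (fun ω : ℝ => spectralDeficit ω₂ lam β γ T N ω) (𝓝[>] 0) (𝓝 (spectralDeficit ω₂ lam β γ T N 0)) :=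
      ((continuous_spectralDeficit hω hl hβ hγ hT N).tendsto 0).mono_left nhdsWithin_le_nhds
    refine ge_of_tendsto hcont ?_
    have hmem : Ioo (0 : ℝ) (1 * (N : ℝ) ^ 2)⁻¹ ∈ 𝓝[>] (0 : ℝ) := Ioo_mem_nhdsGT (inv_pos.2 ht)
    filter_upwards [hmem] with ω hωI
    refine hη N hNN₀ ω hωI.1 ?_
    have h := mul_le_mul_of_nonneg_right hωI.2.le ht.le
    rwa [inv_mul_cancel₀ ht.ne'] at h
  rw [spectralDeficit_zero] at hlim
  have h1 : (θ - 1) * escapeDeficit ω₂ lam β γ T N ≤ η / N := by linarith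
  rw [div_div, le_div_iff₀ (mul_pos hθ1 hNpos)]
  have h2 := (le_div_iff₀ hNpos).1 h1
  linarith

/-- **Above the critical grade the band floor IS the blocker (up to (FC))**: `θ > 1 ⟹ (BandDeficitFloor θ ⟺ OhmicFloor)` beneath (FC). [this cell] -/
theorem bandDeficitFloor_iff_ohmicFloor_of_one_lt {θ : ℝ} (hθ : 1 < θ) (hFC : SpectralDeficitNonneg) : BandDeficitFloor θ ↔ OhmicFloor :=
  ⟨ohmicFloor_of_bandDeficitFloor_of_one_lt hθ, bandDeficitFloor_of_ohmicFloor (by linarith) hFC⟩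

end Summit.AtomisticToContinuum.FouriersLaw.Theorems.BoundedResponse.HeatSpreading

end
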